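import Literature.Topology.FourManifolds.SurfaceGroupHomologyMoveBlocks
import Mathlib.GroupTheory.Perm.Sign
import Mathlib.LinearAlgebra.Pi
import HarnessLib

/-!
# `Aut(S_g) → Sp(H₁(Σ_g; ℤ))` hits every elementary symplectic move
# (Zieschang–Vogt–Coldewey Thm. 3.6.7 (b) / 3.6.9, all handles, pairs and permutations)

Topic `Literature/Topology/FourManifolds`; theorems only, sequel to
`SurfaceGroupHomologyMoveBlocks.lean` (the four local blocks).

* `shear_add`, `shear_zero`, `shear_mem` — `shear N (c + d) = shear N c · shear N d`, so a
  subgroup containing a move with parameter `1` contains it with every integer parameter;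
  `permHandles_mul`, `permHandles_one`;
* `exists_realises_moveX_one`, `exists_realises_moveY_one` (every handle),
  `exists_realises_swap_castSucc_succ`, `exists_realises_permHandles` (every permutation of the
  handles, type (B): adjacent transpositions generate, `Equiv.Perm.mclosure_swap_castSucc_succ`),
  `permHandles_mul_moveZ_mul_inv` + `exists_realises_moveZ_one` (every pair `i ≠ j`, type (C), by
  conjugating the placed `α` with a permutation), `moveW_one_eq`
  (`W_{ij}(1) = Z_{ij}(1) X_j(1) Z_{ij}(-1) X_i(-1) X_j(-1)`);
* consequence (proved where it is consumed, `Summits/SmoothPoincare4/…/Theorems/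
  CongruenceShadowsAbelianShadowStandard.lean`, together with `SymplecticBasisTransitivity`):
  every symplectic basis of `H₁` is realised by an automorphism of `S_g` (ZVC 3.6.7 (b)).

Not here: the converse (every automorphism of `S_g` acts symplectically up to sign, 3.6.7 (a)),
orientation reversal (type (D)), Dehn–Nielsen.

## References

* H. Zieschang, E. Vogt, H.-D. Coldewey, *Surfaces and Planar Discontinuous Groups*, LNM 835,
  Springer (1980), §3.6: Thm. 3.6.7 (b), 3.6.9, Cor. 3.6.12. [ZieschangVogtColdewey1980]
-/

noncomputable section

namespace Literature.Topology.FourManifolds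

open Finset Multiplicative

section Shear

variable {ι : Type*} [DecidableEq ι]

/-- `shear` is additive in its parameter: `(1 + cN)(1 + dN) = 1 + (c + d)N`. [folklore] -/
theorem shear_add {V : Type*} [AddCommGroup V] (N : V →ₗ[ℤ] V) (hN : ∀ v, N (N v) = 0)
    (c d : ℤ) : shear N hN (c + d) = shear N hN c * shear N hN d := by
  ext v
  change v + (c + d) • N v = (v + d • N v) + c • N (v + d • N v)
  rw [map_add, LinearMap.map_smul, hN, smul_zero, add_zero, add_smul]
  abel

/-- `shear N 0 = 1`. [folklore] -/
theorem shear_zero {V : Type*} [AddCommGroup V] (N : V →ₗ[ℤ] V) (hN : ∀ v, N (N v) = 0) :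
    shear N hN 0 = 1 := by
  ext v
  change v + (0 : ℤ) • N v = v
  rw [zero_smul, add_zero]

/-- A subgroup containing `shear N 1` contains every `shear N c`. [folklore] -/
theorem shear_mem {V : Type*} [AddCommGroup V] (N : V →ₗ[ℤ] V) (hN : ∀ v, N (N v) = 0)
    (G : Subgroup (V ≃ₗ[ℤ] V)) (h1 : shear N hN 1 ∈ G) (c : ℤ) : shear N hN c ∈ G := by
  induction c using Int.induction_on with
  | zero => rw [shear_zero]; exact G.one_mem
  | succ c ih => rw [shear_add]; exact G.mul_mem ih h1
  | pred c ih =>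
    have hneg : shear N hN (-1) = (shear N hN 1)⁻¹ := by
      rw [eq_inv_iff_mul_eq_one, ← shear_add, neg_add_cancel, shear_zero]
    rw [sub_eq_add_neg, shear_add, hneg]
    exact G.mul_mem ih (G.inv_mem h1)

omit [DecidableEq ι] in
/-- `permHandles` is multiplicative. [folklore] -/
theorem permHandles_mul (π π' : Equiv.Perm ι) :
    (permHandles (π * π') : (ι × Bool → ℤ) ≃ₗ[ℤ] (ι × Bool → ℤ)) = permHandles π * permHandles π' := by
  ext v x
  rw [linearEquiv_mul_apply, permHandles_apply, permHandles_apply, permHandles_apply]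
  rfl

end Shear

section RealisationAll

open Multiplicative

/-- `moveX i 1` is realised at every handle `i` of every genus. [cite: ZieschangVogtColdewey1980, 3.6.9 (A)] -/
theorem exists_realises_moveX_one (g : ℕ) (i : Fin g) :
    ∃ σ : SurfaceGroup g ≃* SurfaceGroup g, ∀ s,
      toAdd (SurfaceGroup.abelianize g (σ s)) = moveX i 1 (toAdd (SurfaceGroup.abelianize g s)) := by
  have key : ∀ (m : ℕ) (i : Fin m) (n n' : ℕ), m = n + 1 + n' → (i : ℕ) = n →
      ∃ σ : SurfaceGroup m ≃* SurfaceGroup m, ∀ s,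
        toAdd (SurfaceGroup.abelianize m (σ s)) = moveX i 1 (toAdd (SurfaceGroup.abelianize m s)) := by
    rintro m i n n' rfl hi
    obtain rfl : i = Fin.castAdd n' (Fin.natAdd n (0 : Fin 1)) := Fin.ext (by simp [hi])
    exact exists_realises_moveX_mid n n'
  exact key g i i (g - i - 1) (by omega) rfl

/-- `moveY i 1` is realised at every handle `i` of every genus. [cite: ZieschangVogtColdewey1980, 3.6.9 (A)] -/
theorem exists_realises_moveY_one (g : ℕ) (i : Fin g) :
    ∃ σ : SurfaceGroup g ≃* SurfaceGroup g, ∀ s,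
      toAdd (SurfaceGroup.abelianize g (σ s)) = moveY i 1 (toAdd (SurfaceGroup.abelianize g s)) := by
  have key : ∀ (m : ℕ) (i : Fin m) (n n' : ℕ), m = n + 1 + n' → (i : ℕ) = n →
      ∃ σ : SurfaceGroup m ≃* SurfaceGroup m, ∀ s,
        toAdd (SurfaceGroup.abelianize m (σ s)) = moveY i 1 (toAdd (SurfaceGroup.abelianize m s)) := by
    rintro m i n n' rfl hi
    obtain rfl : i = Fin.castAdd n' (Fin.natAdd n (0 : Fin 1)) := Fin.ext (by simp [hi])
    exact exists_realises_moveY_mid n n'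
  exact key g i i (g - i - 1) (by omega) rfl

/-- The adjacent transpositions of handles are realised. [cite: ZieschangVogtColdewey1980, 3.6.9 (B)] -/
theorem exists_realises_swap_castSucc_succ (m : ℕ) (i : Fin m) :
    ∃ σ : SurfaceGroup (m + 1) ≃* SurfaceGroup (m + 1), ∀ s,
      toAdd (SurfaceGroup.abelianize (m + 1) (σ s)) =
        permHandles (Equiv.swap i.castSucc i.succ) (toAdd (SurfaceGroup.abelianize (m + 1) s)) := by
  have key : ∀ (M : ℕ) (i j : Fin M) (n n' : ℕ), M = n + 2 + n' → (i : ℕ) = n → (j : ℕ) = n + 1 →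
      ∃ σ : SurfaceGroup M ≃* SurfaceGroup M, ∀ s,
        toAdd (SurfaceGroup.abelianize M (σ s)) =
          permHandles (Equiv.swap i j) (toAdd (SurfaceGroup.abelianize M s)) := by
    rintro M i j n n' rfl hi hj
    obtain rfl : i = Fin.castAdd n' (Fin.natAdd n (0 : Fin 2)) := Fin.ext (by simp [hi])
    obtain rfl : j = Fin.castAdd n' (Fin.natAdd n (1 : Fin 2)) := Fin.ext (by simp [hj])
    exact exists_realises_swap_mid n n'
  exact key (m + 1) i.castSucc i.succ i (m - i - 1) (by omega) (by simp) (by simp)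

/-- `permHandles 1 = 1`. [folklore] -/
theorem permHandles_one {ι : Type*} :
    (permHandles (1 : Equiv.Perm ι) : (ι × Bool → ℤ) ≃ₗ[ℤ] (ι × Bool → ℤ)) = 1 := by
  ext v x
  rfl

/-- **Every permutation of the handles is realised** (ZVC 3.6.9 (B)): adjacent transpositions
generate the symmetric group (`Equiv.Perm.mclosure_swap_castSucc_succ`) and realisers compose.
[cite: ZieschangVogtColdewey1980, 3.6.9 (B)] -/
theorem exists_realises_permHandles (g : ℕ) (π : Equiv.Perm (Fin g)) :
    ∃ σ : SurfaceGroup g ≃* SurfaceGroup g, ∀ s,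
      toAdd (SurfaceGroup.abelianize g (σ s)) = permHandles π (toAdd (SurfaceGroup.abelianize g s)) := by
  cases g with
  | zero =>
    obtain rfl : π = 1 := Subsingleton.elim _ _
    exact ⟨MulEquiv.refl _, fun s => by rw [permHandles_one]; rfl⟩
  | succ m =>
    have hπ : π ∈ Submonoid.closure (Set.range fun i : Fin m => Equiv.swap i.castSucc i.succ) := by
      rw [Equiv.Perm.mclosure_swap_castSucc_succ]; exact Submonoid.mem_top π
    induction hπ using Submonoid.closure_induction with
    | mem π hπ =>
      obtain ⟨i, rfl⟩ := hπ
      exact exists_realises_swap_castSucc_succ m i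
    | one => exact ⟨MulEquiv.refl _, fun s => by rw [permHandles_one]; rfl⟩
    | mul π π' _ _ ih ih' =>
      obtain ⟨σ, hσ⟩ := ih
      obtain ⟨τ, hτ⟩ := ih'
      exact ⟨τ.trans σ, fun s => by rw [permHandles_mul]; exact realises_mul hσ hτ s⟩

/-- Conjugating a move of type (C) by a permutation of the handles relabels it. [folklore] -/
theorem permHandles_mul_moveZ_mul_inv {ι : Type*} [Fintype ι] [DecidableEq ι] (π : Equiv.Perm ι)
    {i j : ι}
    (h : i ≠ j) (c : ℤ) :
    (permHandles π * moveZ i j h c * (permHandles π)⁻¹ :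
        (ι × Bool → ℤ) ≃ₗ[ℤ] (ι × Bool → ℤ)) =
      moveZ (π i) (π j) (fun e => h (π.injective e)) c := by
  rw [mul_inv_eq_iff_eq_mul]
  refine LinearEquiv.toLinearMap_injective (LinearMap.pi_ext fun x n => ?_)
  change permHandles π (moveZ i j h c (Pi.single x n)) =
    moveZ (π i) (π j) (fun e => h (π.injective e)) c (permHandles π (Pi.single x n))
  by_cases hx : x = (j, false)
  · subst hx
    rw [moveZ_single_false, permHandles_single, moveZ_single_false, map_add, map_zsmul,
      permHandles_single, permHandles_single]
  · by_cases hx' : x = (i, true)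
    · subst hx'
      rw [moveZ_single_true, permHandles_single, moveZ_single_true, map_sub, map_zsmul,
        permHandles_single, permHandles_single]
    · rw [moveZ_single_of_ne h c hx hx', permHandles_single, moveZ_single_of_ne]
      · simpa [Prod.ext_iff] using hx
      · simpa [Prod.ext_iff] using hx'

/-- For `i ≠ j` in `Fin g` there is a permutation with `π 1 = i`, `π 0 = j` (`g ≥ 2`). [folklore] -/
theorem exists_perm_apply_eq {g : ℕ} (i j : Fin (g + 2)) (h : i ≠ j) :
    ∃ π : Equiv.Perm (Fin (g + 2)), π 1 = i ∧ π 0 = j := by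
  refine ⟨(Equiv.swap 1 (Equiv.swap 0 j i)).trans (Equiv.swap 0 j), ?_, ?_⟩
  · simp
  · have hk : Equiv.swap (0 : Fin (g + 2)) j i ≠ 0 := by
      intro hk
      rw [Equiv.swap_apply_eq_iff, Equiv.swap_apply_left] at hk
      exact h hk
    rw [Equiv.trans_apply, Equiv.swap_apply_of_ne_of_ne (by simp) hk.symm, Equiv.swap_apply_left]

/-- **Every move of type (C) is realised**: `moveZ i j 1` for all `i ≠ j`, by conjugating the
placed automorphism `α` with handle permutations. [cite: ZieschangVogtColdewey1980, 3.6.9 (C)] -/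
theorem exists_realises_moveZ_one (g : ℕ) (i j : Fin g) (h : i ≠ j) :
    ∃ σ : SurfaceGroup g ≃* SurfaceGroup g, ∀ s,
      toAdd (SurfaceGroup.abelianize g (σ s)) = moveZ i j h 1 (toAdd (SurfaceGroup.abelianize g s)) := by
  -- genus at least two
  obtain ⟨n', rfl⟩ : ∃ n', g = 0 + 2 + n' := by
    rcases Nat.lt_or_ge g 2 with hg | hg
    · exfalso
      have : Subsingleton (Fin g) := by
        rcases Nat.lt_succ_iff.1 hg with _ | hg'
        · exact ⟨fun a b => Fin.ext (by omega)⟩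
        · exact ⟨fun a b => Fin.ext (by omega)⟩
      exact h (Subsingleton.elim i j)
    · exact ⟨g - 2, by omega⟩
  obtain ⟨σ₀, hσ₀⟩ := exists_realises_moveZ_mid 0 n'
  set I : Fin (0 + 2 + n') := Fin.castAdd n' (Fin.natAdd 0 (1 : Fin 2)) with hI
  set J : Fin (0 + 2 + n') := Fin.castAdd n' (Fin.natAdd 0 (0 : Fin 2)) with hJ
  -- a permutation carrying `(I, J)` to `(i, j)`
  have hIJ : I ≠ J := mid_one_ne_mid_zero 0 n'
  obtain ⟨π, hπi, hπj⟩ : ∃ π : Equiv.Perm (Fin (0 + 2 + n')), π I = i ∧ π J = j := by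
    have hI1 : I = ⟨1, by omega⟩ := Fin.ext (by simp [hI])
    have hJ0 : J = ⟨0, by omega⟩ := Fin.ext (by simp [hJ])
    have e : 0 + 2 + n' = n' + 2 := by omega
    obtain ⟨π, h1, h0⟩ := exists_perm_apply_eq (i.cast e) (j.cast e) (fun hij => h (by
      simpa using congrArg (Fin.cast e.symm) hij))
    refine ⟨(finCongr e).trans (π.trans (finCongr e.symm)), ?_, ?_⟩
    · rw [hI1]
      apply Fin.ext
      have := congrArg Fin.val h1
      simpa using this
    · rw [hJ0]
      apply Fin.ext
      have := congrArg Fin.val h0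
      simpa using this
  obtain ⟨ρ, hρ⟩ := exists_realises_permHandles _ π
  refine ⟨(ρ.symm.trans σ₀).trans ρ, fun s => ?_⟩
  have key := realises_mul (realises_mul hρ hσ₀) (realises_inv hρ) s
  rw [permHandles_mul_moveZ_mul_inv] at key
  rw [MulEquiv.trans_apply, MulEquiv.trans_apply]
  rw [MulEquiv.trans_apply, MulEquiv.trans_apply] at key
  rw [key]
  congr 1
  subst hπi hπj
  rfl

/-- `moveW i j 1` as a product of moves of types (A) and (C):
`W_{ij}(1) = Z_{ij}(1) X_j(1) Z_{ij}(-1) X_i(-1) X_j(-1)` (the symmetric shear `T(Eᵢⱼ + Eⱼᵢ)` is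
`D(A) T(Eⱼⱼ) D(A)⁻¹ T(Eᵢᵢ)⁻¹ T(Eⱼⱼ)⁻¹` with `A = 1 + Eᵢⱼ`). [folklore] -/
theorem moveW_one_eq {ι : Type*} [DecidableEq ι] {i j : ι} (h : i ≠ j) :
    (moveW i j 1 : (ι × Bool → ℤ) ≃ₗ[ℤ] (ι × Bool → ℤ)) =
      moveZ i j h 1 * moveX j 1 * moveZ i j h (-1) * moveX i (-1) * moveX j (-1) := by
  ext v x
  simp only [linearEquiv_mul_apply, moveW_apply, moveZ_apply, moveX_apply, Pi.add_apply,
    Pi.sub_apply, Pi.smul_apply, smul_eq_mul, Pi.single_apply]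
  obtain ⟨k, b⟩ := x
  by_cases hki : k = i
  · subst hki
    cases b
    · simp [h, h.symm]
      ring
    · simp [h]
  · by_cases hkj : k = j
    · subst hkj
      cases b
      · simp [h, h.symm]
      · simp [h, h.symm]
    · cases b <;> simp [hki, hkj]

end RealisationAll

end Literature.Topology.FourManifolds

end
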